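import Mathlib
import HarnessLib
import Summits.Langlands.Statement
import Summits.Langlands.Langlands.Theses.PrimeSwitchSplit
import Summits.Langlands.Langlands.Theses.DepthPrimeSplit
import Summits.Langlands.Langlands.Theses.WeightMultiplicitySplit
import Summits.Langlands.Langlands.Theorems.WeightMultiplicitySplitMinusculeHodgeType
import Literature.NumberTheory.GaloisRepresentations.LabelledHodgeTateWeights
import Literature.NumberTheory.PAdicHodge.FontaineDpst
import Literature.NumberTheory.GaloisRepresentations.LabelledWeightsDeRhamRank
import Literature.NumberTheory.GaloisRepresentations.PadicEmbeddingPlaces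
import Literature.NumberTheory.Automorphic.FontaineMazurGL2WeightOne
import Summits.Langlands.Langlands.Theorems.DepthPrimeSplitClassicalityWeight

/-!
# DepthPrimeSplitClassicalityWeightLayers — Theorems-side twin (PART B) of the lens-2 g17 node `ClassicalityWeightSplit`

§8 the weight-one box over ℚ (`WeightOneBoxQ`, `weightOneBox_of_pan` from the tree fact `Pan2022_fontaineMazurGL2_weightOne` BY NAME,
`weightOneBox_isWall`: it lies in the WALL chamber); §9 LAYER 2 — the rank rungs of the three cells (`WallRankLeOne` and `DegenerateRankLeTwo` are
THEOREMS: empty chambers by the tree's `card = n`; `WallRankTwoOdd` = the weight-one sector proper, `WallRankTwoNonOdd` = the Maass-type hard core; `RegularRankLeTwo` / `RegularRankGeThree`;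
`DegenerateIsotypicRankGeThree` / `DegenerateMixedRankGeThree`) with the skeleton seams `…_of_ranks` / `…_iff_ranks` and `classicality_iff_layer2`;
§10 guards.  Imports PART A.  No `sorry`, no new axioms.
-/

set_option linter.dupNamespace false
set_option linter.unusedVariables false

namespace Summit.Langlands.Langlands.Theorems.DepthPrimeSplitClassicalityWeightLayers
open scoped NumberField
open Filter Field IsDedekindDomain
open Literature.NumberTheory.GaloisRepresentations Literature.NumberTheory.Automorphic
open Summit.Langlands.Langlands.Theorems.WeightMultiplicitySplitMinusculeHodgeType (HodgeTateMultLE IsWallHT)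
open Summit.Langlands.Langlands.Theorems.DepthPrimeSplitClassicalityWeight

/-! ## 8. LENS CERTIFICATE on the special side: the weight-one box over ℚ (where CW is a theorem in print) -/

/-- The WEIGHT-ONE BOX of CW over ℚ under Pan's printed hypotheses (Forum Math. Pi 10 (2022) Thm 1.0.5 = tree fact
`Pan2022_fontaineMazurGL2_weightOne`: ℓ ≠ 2, ρ odd, ρ̄|ℚ(μ_ℓ) absolutely irreducible, residually generic at ℓ, labelled Hodge–Tate weights {0,0}):
CW's text specialised to `K = ℚ`, `n = 2`, with these hypotheses ADDED — and it holds WITHOUT USING pro-automorphy (Fontaine–Mazur is stronger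
than classicality in this box).  Pan's Thm 1.0.4 (pro-modular + HT (0,0) ⟹ classical, NO parity / Taylor–Wiles / genericity hypothesis) is the
box's classicality theorem proper; it is not yet a tree fact (instrument I-g17.1 of the memo). -/
def WeightOneBoxQ : Prop :=
  ∀ (hcpt : isCompact_glFiniteIntegralLevel 2 ℚ) (ℓ : ℕ) [Fact ℓ.Prime], ℓ ≠ 2 → ∀ (ι : PadicAlgCl ℓ ≃+* ℂ) (ρ : FramedGaloisRep ℚ (PadicAlgCl ℓ) 2),
    ρ.toGaloisRep.IsIrreducible → IsPinnedGeometric ρ → ρ.IsOdd →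
    (ρ.restrictField (CyclotomicField ℓ ℚ)).IsResiduallyAbsIrreducible →
    (∀ v : HeightOneSpectrum (𝓞 ℚ), ((ℓ : ℕ) : 𝓞 ℚ) ∈ v.asIdeal → IsResiduallyGenericGL2At ρ v) →
    IsDeRhamWeightZeroGL2 ℓ ρ →
    IsProAutomorphic hcpt ι ρ → IsWeaklyAutomorphic hcpt ι ρ

/-- KERNEL SECTOR CERTIFICATE: the weight-one box follows from the tree's named fact (pro-automorphy unused). -/
theorem weightOneBox_of_pan (h : Pan2022_fontaineMazurGL2_weightOne) : WeightOneBoxQ := by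
  intro hcpt ℓ _ hℓ ι ρ hirr hgeo hodd hres hgen hdr _
  obtain ⟨π, hL, hae⟩ := h ℓ hℓ ρ hgeo.1 hirr hodd hres hgen hdr hcpt ι
  exact ⟨π, hL, hae.mono fun v hv => hv⟩

/-- In the weight-one box `ρ` IS of wall type (so the box is a sub-box of CW's chamber — kernel). -/
theorem weightOneBox_isWall {ℓ : ℕ} [Fact ℓ.Prime] {ρ : FramedGaloisRep ℚ (PadicAlgCl ℓ) 2} (hdr : IsDeRhamWeightZeroGL2 ℓ ρ) : IsWallHT ρ :=
  isWallHT_of_weights_eq_pair fun v hv τ hτ => (hdr v hv).2 τ hτ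

/- The REGULAR cell's rank-two engine over ℚ exists in the tree BY NAME: `Literature.NumberTheory.Automorphic.Pan2022_proModularDeRhamClassical_GL2Q`
(Pan II Thm 1.1.2, every p; module `Literature/NumberTheory/Automorphic/ProModularDeRhamClassicalGL2Q.lean`, not imported here to keep the node's
import cone inside the farm snapshot): its pro-modularity hypothesis is the completed-cohomology Hecke-algebra point
`BigHeckeGLn.TameLevel.IsPadicallyAutomorphic`, its regularity clause `Nodup` = multiplicity ≤ 1 = this node's REGULAR dial at (ℚ, n = 2). -/

/-! ## 9. LAYER 2 (kernel): rank rungs and the skeleton seams of the three cells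

Every sub-box below is its cell's text with ONE rank clause after `0 < n →` (and ONE sub-dial: PARITY `ρ.IsOdd` for CW at rank 2, ISOTYPIC for CD at
rank ≥ 3); the seams are excluded middle / `omega` on the rank.  Two rungs are THEOREMS (vacuous chambers, by the tree's `card = n`): CW in rank ≤ 1, CD in rank ≤ 2. -/

/-- CW · rank ≤ 1 sub-box — a THEOREM: no wall type in rank ≤ 1. -/
def WallRankLeOne : Prop :=
  ∀ (K : Type) [Field K] [NumberField K] (n : ℕ) (hcpt : Literature.NumberTheory.Automorphic.isCompact_glFiniteIntegralLevel n K), 0 < n → n ≤ 1 → ∀ (ℓ : ℕ) [Fact ℓ.Prime] (ι : PadicAlgCl ℓ ≃+* ℂ) (ρ : Literature.NumberTheory.GaloisRepresentations.FramedGaloisRep K (PadicAlgCl ℓ) n), ρ.toGaloisRep.IsIrreducible → ((∀ᶠ v : IsDedekindDomain.HeightOneSpectrum (NumberField.RingOfIntegers K) in cofinite, ρ.IsUnramifiedAt v) ∧ ∀ (v : IsDedekindDomain.HeightOneSpectrum (NumberField.RingOfIntegers K)) (hv : ((ℓ : ℕ) : NumberField.RingOfIntegers K) ∈ v.asIdeal),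 (Literature.NumberTheory.PAdicHodge.fontainePstAdicCompletion v ℓ hv).IsDeRhamFramed (ρ.toLocal v)) → Summit.Langlands.Langlands.Theorems.WeightMultiplicitySplitMinusculeHodgeType.IsWallHT ρ → (∃ S : Set (IsDedekindDomain.HeightOneSpectrum (NumberField.RingOfIntegers K)), S.Finite ∧ ∀ r : NNReal, 0 < r → ∃ π : Literature.NumberTheory.Automorphic.CuspidalAutomorphicRepData n K hcpt, π.1.IsLAlgebraic ∧ ∀ v : IsDedekindDomain.HeightOneSpectrum (NumberField.RingOfIntegers K), v ∉ S → (∃ α : Multiset ℂ, π.1.HasSatakeParamAt v α ∧ ∀ 𝔓 ∈ v.primesAbove, ∀ σ : Field.absoluteGaloisGroup K, IsArithFrobAt (NumberField.RingOfIntegers K) σ 𝔓 → ∀ i : ℕ, Valued.v ((Literature.NumberTheory.GaloisRepresentations.FramedRep.charpoly ρ σ - Literature.NumberTheory.Automorphic.arithFrobPolyOfSatake ι v.residueCard 1 α).coeff i) < r)) → ∃ π : Literature.NumberTheory.Automorphic.CuspidalAutomorphicRepData n K hcpt, π.1.IsLAlgebraic ∧ ∀ᶠ v : IsDedekindDomain.HeightOneSpectrum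 (NumberField.RingOfIntegers K) in cofinite, SatakeFrobCompatibleAt ι π.1 ρ v

/-- CW · rank 2 · ODD sub-box = THE WEIGHT-ONE SECTOR proper (labelled weights {a,a} at some labelled place; `det ρ(c) = -1` at every real place —
vacuous for totally complex K): classical / Hilbert / Bianchi weight one and partial weight one (Pan 2022 Thm 1.0.4 over ℚ for 𝕋-pro-modular ρ, ANY ℓ, no
residual hypothesis; Buzzard–Taylor; Kassaei, Sasaki, Pilloni–Stroh) — stub `stub_wallRankTwoOdd` of CW's skeleton, the route's BC5 plan-only rung. -/
def WallRankTwoOdd : Prop :=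
  ∀ (K : Type) [Field K] [NumberField K] (n : ℕ) (hcpt : Literature.NumberTheory.Automorphic.isCompact_glFiniteIntegralLevel n K), 0 < n → n = 2 → ∀ (ℓ : ℕ) [Fact ℓ.Prime] (ι : PadicAlgCl ℓ ≃+* ℂ) (ρ : Literature.NumberTheory.GaloisRepresentations.FramedGaloisRep K (PadicAlgCl ℓ) n), ρ.toGaloisRep.IsIrreducible → ((∀ᶠ v : IsDedekindDomain.HeightOneSpectrum (NumberField.RingOfIntegers K) in cofinite, ρ.IsUnramifiedAt v) ∧ ∀ (v : IsDedekindDomain.HeightOneSpectrum (NumberField.RingOfIntegers K)) (hv : ((ℓ : ℕ) : NumberField.RingOfIntegers K) ∈ v.asIdeal), (Literature.NumberTheory.PAdicHodge.fontainePstAdicCompletion v ℓ hv).IsDeRhamFramed (ρ.toLocal v)) → Summit.Langlands.Langlands.Theorems.WeightMultiplicitySplitMinusculeHodgeType.IsWallHT ρ → ρ.IsOdd → (∃ S : Set (IsDedekindDomain.HeightOneSpectrum (NumberField.RingOfIntegers K)), S.Finite ∧ ∀ r : NNReal, 0 < r → ∃ π : Literature.NumberTheory.Automorphic.CuspidalAutomorphicRepData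 n K hcpt, π.1.IsLAlgebraic ∧ ∀ v : IsDedekindDomain.HeightOneSpectrum (NumberField.RingOfIntegers K), v ∉ S → (∃ α : Multiset ℂ, π.1.HasSatakeParamAt v α ∧ ∀ 𝔓 ∈ v.primesAbove, ∀ σ : Field.absoluteGaloisGroup K, IsArithFrobAt (NumberField.RingOfIntegers K) σ 𝔓 → ∀ i : ℕ, Valued.v ((Literature.NumberTheory.GaloisRepresentations.FramedRep.charpoly ρ σ - Literature.NumberTheory.Automorphic.arithFrobPolyOfSatake ι v.residueCard 1 α).coeff i) < r)) → ∃ π : Literature.NumberTheory.Automorphic.CuspidalAutomorphicRepData n K hcpt, π.1.IsLAlgebraic ∧ ∀ᶠ v : IsDedekindDomain.HeightOneSpectrum (NumberField.RingOfIntegers K) in cofinite, SatakeFrobCompatibleAt ι π.1 ρ v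

/-- CW · rank 2 · NON-ODD sub-box (`det ρ(c) = +1` at some real place: the automorphic avatar must be of MAASS type there — even Artin-type weight (0,0),
the cell census's hard core HC1, e.g. `EvenIcosahedralStrongArtin` stmt-2903 / `EvenIcosahedralCM` 14074–8; no p-adic engine: overconvergent-to-classical
and Pan's locally analytic method reach only odd = holomorphic-limit points) — stub `stub_wallRankTwoNonOdd`; a BARRIER leaf inside the ATTACKED cell. -/
def WallRankTwoNonOdd : Prop :=
  ∀ (K : Type) [Field K] [NumberField K] (n : ℕ) (hcpt : Literature.NumberTheory.Automorphic.isCompact_glFiniteIntegralLevel n K), 0 < n → n = 2 → ∀ (ℓ : ℕ) [Fact ℓ.Prime] (ι : PadicAlgCl ℓ ≃+* ℂ) (ρ : Literature.NumberTheory.GaloisRepresentations.FramedGaloisRep K (PadicAlgCl ℓ) n), ρ.toGaloisRep.IsIrreducible → ((∀ᶠ v : IsDedekindDomain.HeightOneSpectrum (NumberField.RingOfIntegers K) in cofinite, ρ.IsUnramifiedAt v) ∧ ∀ (v : IsDedekindDomain.HeightOneSpectrum (NumberField.RingOfIntegers K)) (hv : ((ℓ : ℕ) : NumberField.RingOfIntegers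 K) ∈ v.asIdeal), (Literature.NumberTheory.PAdicHodge.fontainePstAdicCompletion v ℓ hv).IsDeRhamFramed (ρ.toLocal v)) → Summit.Langlands.Langlands.Theorems.WeightMultiplicitySplitMinusculeHodgeType.IsWallHT ρ → ¬ ρ.IsOdd → (∃ S : Set (IsDedekindDomain.HeightOneSpectrum (NumberField.RingOfIntegers K)), S.Finite ∧ ∀ r : NNReal, 0 < r → ∃ π : Literature.NumberTheory.Automorphic.CuspidalAutomorphicRepData n K hcpt, π.1.IsLAlgebraic ∧ ∀ v : IsDedekindDomain.HeightOneSpectrum (NumberField.RingOfIntegers K), v ∉ S → (∃ α : Multiset ℂ, π.1.HasSatakeParamAt v α ∧ ∀ 𝔓 ∈ v.primesAbove, ∀ σ : Field.absoluteGaloisGroup K, IsArithFrobAt (NumberField.RingOfIntegers K) σ 𝔓 → ∀ i : ℕ, Valued.v ((Literature.NumberTheory.GaloisRepresentations.FramedRep.charpoly ρ σ - Literature.NumberTheory.Automorphic.arithFrobPolyOfSatake ι v.residueCard 1 α).coeff i) < r)) → ∃ π : Literature.NumberTheory.Automorphic.CuspidalAutomorphicRepData n K hcpt, π.1.IsLAlgebraic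 ∧ ∀ᶠ v : IsDedekindDomain.HeightOneSpectrum (NumberField.RingOfIntegers K) in cofinite, SatakeFrobCompatibleAt ι π.1 ρ v

/-- CW · rank ≥ 3 sub-box (abelian-surface type {0,0,1,1}: Boxer–Calegari–Gee–Pilloni II; Picard type {0,0,1}; U(a,b) wall weights; partial weight one in
rank ≥ 3) — stub `stub_wallRankGeThree`. -/
def WallRankGeThree : Prop :=
  ∀ (K : Type) [Field K] [NumberField K] (n : ℕ) (hcpt : Literature.NumberTheory.Automorphic.isCompact_glFiniteIntegralLevel n K), 0 < n → 3 ≤ n → ∀ (ℓ : ℕ) [Fact ℓ.Prime] (ι : PadicAlgCl ℓ ≃+* ℂ) (ρ : Literature.NumberTheory.GaloisRepresentations.FramedGaloisRep K (PadicAlgCl ℓ) n), ρ.toGaloisRep.IsIrreducible → ((∀ᶠ v : IsDedekindDomain.HeightOneSpectrum (NumberField.RingOfIntegers K) in cofinite, ρ.IsUnramifiedAt v) ∧ ∀ (v : IsDedekindDomain.HeightOneSpectrum (NumberField.RingOfIntegers K)) (hv : ((ℓ : ℕ) : NumberField.RingOfIntegers K) ∈ v.asIdeal), (Literature.NumberTheory.PAdicHodge.fontainePstAdicCompletion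 v ℓ hv).IsDeRhamFramed (ρ.toLocal v)) → Summit.Langlands.Langlands.Theorems.WeightMultiplicitySplitMinusculeHodgeType.IsWallHT ρ → (∃ S : Set (IsDedekindDomain.HeightOneSpectrum (NumberField.RingOfIntegers K)), S.Finite ∧ ∀ r : NNReal, 0 < r → ∃ π : Literature.NumberTheory.Automorphic.CuspidalAutomorphicRepData n K hcpt, π.1.IsLAlgebraic ∧ ∀ v : IsDedekindDomain.HeightOneSpectrum (NumberField.RingOfIntegers K), v ∉ S → (∃ α : Multiset ℂ, π.1.HasSatakeParamAt v α ∧ ∀ 𝔓 ∈ v.primesAbove, ∀ σ : Field.absoluteGaloisGroup K, IsArithFrobAt (NumberField.RingOfIntegers K) σ 𝔓 → ∀ i : ℕ, Valued.v ((Literature.NumberTheory.GaloisRepresentations.FramedRep.charpoly ρ σ - Literature.NumberTheory.Automorphic.arithFrobPolyOfSatake ι v.residueCard 1 α).coeff i) < r)) → ∃ π : Literature.NumberTheory.Automorphic.CuspidalAutomorphicRepData n K hcpt, π.1.IsLAlgebraic ∧ ∀ᶠ v : IsDedekindDomain.HeightOneSpectrum (NumberField.RingOfIntegers K) in cofinite,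 SatakeFrobCompatibleAt ι π.1 ρ v

/-- CW · rank ≤ 1 is a THEOREM: the chamber is empty (tree `card = n`). -/
theorem wallRankLeOne_holds : WallRankLeOne :=
  fun K _ _ n hcpt hn hle ℓ _ ι ρ hirr hgeo hw _ => (not_wall_of_rank_le_one hle hgeo hw).elim

/-- CW ⟹ its odd rank-2 sub-box (the weight-one sector). -/
theorem wallRankTwoOdd_of_wall (h : WallClassicality) : WallRankTwoOdd :=
  fun K _ _ n hcpt hn _ ℓ _ ι ρ hirr hgeo hw _ hpro => h K n hcpt hn ℓ ι ρ hirr hgeo hw hpro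

/-- CW ⟹ its non-odd rank-2 sub-box (Maass-type hard core). -/
theorem wallRankTwoNonOdd_of_wall (h : WallClassicality) : WallRankTwoNonOdd :=
  fun K _ _ n hcpt hn _ ℓ _ ι ρ hirr hgeo hw _ hpro => h K n hcpt hn ℓ ι ρ hirr hgeo hw hpro

/-- CW ⟹ its rank-≥-3 sub-box. -/
theorem wallRankGeThree_of_wall (h : WallClassicality) : WallRankGeThree :=
  fun K _ _ n hcpt hn _ ℓ _ ι ρ hirr hgeo hw hpro => h K n hcpt hn ℓ ι ρ hirr hgeo hw hpro

/-- SEAM of CW's skeleton: rank ≤ 1 is the theorem above; at rank 2 excluded middle on PARITY (odd = weight-one sector / non-odd = Maass-type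
hard core); rank ≥ 3. -/
theorem wallClassicality_of_ranks (h2o : WallRankTwoOdd) (h2e : WallRankTwoNonOdd) (h3 : WallRankGeThree) : WallClassicality := by
  intro K _ _ n hcpt hn ℓ _ ι ρ hirr hgeo hw hpro
  rcases Nat.lt_or_ge n 3 with hlt | hge
  · rcases Nat.lt_or_ge n 2 with hlt2 | hge2
    · exact wallRankLeOne_holds K n hcpt hn (by omega) ℓ ι ρ hirr hgeo hw hpro
    · by_cases hodd : ρ.IsOdd
      · exact h2o K n hcpt hn (by omega) ℓ ι ρ hirr hgeo hw hodd hpro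
      · exact h2e K n hcpt hn (by omega) ℓ ι ρ hirr hgeo hw hodd hpro
  · exact h3 K n hcpt hn hge ℓ ι ρ hirr hgeo hw hpro

/-- CW ⟺ (rank 2 odd) ∧ (rank 2 non-odd) ∧ (rank ≥ 3). -/
theorem wallClassicality_iff_ranks : WallClassicality ↔ WallRankTwoOdd ∧ WallRankTwoNonOdd ∧ WallRankGeThree :=
  ⟨fun h => ⟨wallRankTwoOdd_of_wall h, wallRankTwoNonOdd_of_wall h, wallRankGeThree_of_wall h⟩,
    fun h => wallClassicality_of_ranks h.1 h.2.1 h.2.2⟩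

/-- The printed WEIGHT-ONE BOX over ℚ (§8) is a sub-box of the ODD rank-2 rung: Pan's hypotheses imply wall type and oddness (kernel). -/
theorem weightOneBoxQ_of_wallRankTwoOdd (h : WallRankTwoOdd) : WeightOneBoxQ :=
  fun hcpt ℓ _ _ ι ρ hirr hgeo hodd _ _ hdr hpro => h ℚ 2 hcpt two_pos rfl ℓ ι ρ hirr hgeo (weightOneBox_isWall hdr) hodd hpro

/-- CG · rank ≤ 2 sub-box (GL₂: Kisin 2003, Emerton 2011 Thm 1.2.4, Pan II = tree fact `Pan2022_proModularDeRhamClassical_GL2Q`; Hilbert: Jiang 2026;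
GL₁: class field theory) — stub `stub_regularRankLeTwo` of CG's skeleton. -/
def RegularRankLeTwo : Prop :=
  ∀ (K : Type) [Field K] [NumberField K] (n : ℕ) (hcpt : Literature.NumberTheory.Automorphic.isCompact_glFiniteIntegralLevel n K), 0 < n → n ≤ 2 → ∀ (ℓ : ℕ) [Fact ℓ.Prime] (ι : PadicAlgCl ℓ ≃+* ℂ) (ρ : Literature.NumberTheory.GaloisRepresentations.FramedGaloisRep K (PadicAlgCl ℓ) n), ρ.toGaloisRep.IsIrreducible → ((∀ᶠ v : IsDedekindDomain.HeightOneSpectrum (NumberField.RingOfIntegers K) in cofinite, ρ.IsUnramifiedAt v) ∧ ∀ (v : IsDedekindDomain.HeightOneSpectrum (NumberField.RingOfIntegers K)) (hv : ((ℓ : ℕ) : NumberField.RingOfIntegers K) ∈ v.asIdeal), (Literature.NumberTheory.PAdicHodge.fontainePstAdicCompletion v ℓ hv).IsDeRhamFramed (ρ.toLocal v)) → Summit.Langlands.Langlands.Theorems.WeightMultiplicitySplitMinusculeHodgeType.HodgeTateMultLE 1 ρ → (∃ S : Set (IsDedekindDomain.HeightOneSpectrum (NumberField.RingOfIntegers K)),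 S.Finite ∧ ∀ r : NNReal, 0 < r → ∃ π : Literature.NumberTheory.Automorphic.CuspidalAutomorphicRepData n K hcpt, π.1.IsLAlgebraic ∧ ∀ v : IsDedekindDomain.HeightOneSpectrum (NumberField.RingOfIntegers K), v ∉ S → (∃ α : Multiset ℂ, π.1.HasSatakeParamAt v α ∧ ∀ 𝔓 ∈ v.primesAbove, ∀ σ : Field.absoluteGaloisGroup K, IsArithFrobAt (NumberField.RingOfIntegers K) σ 𝔓 → ∀ i : ℕ, Valued.v ((Literature.NumberTheory.GaloisRepresentations.FramedRep.charpoly ρ σ - Literature.NumberTheory.Automorphic.arithFrobPolyOfSatake ι v.residueCard 1 α).coeff i) < r)) → ∃ π : Literature.NumberTheory.Automorphic.CuspidalAutomorphicRepData n K hcpt, π.1.IsLAlgebraic ∧ ∀ᶠ v : IsDedekindDomain.HeightOneSpectrum (NumberField.RingOfIntegers K) in cofinite, SatakeFrobCompatibleAt ι π.1 ρ v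

/-- CG · rank ≥ 3 sub-box (Breuil–Hellmann–Schraen 2019 / Breuil–Ding 2023 for polarisable crystalline generic points; GL_n over CM fields with
l₀ > 0: IDEA-NEEDED) — stub `stub_regularRankGeThree`. -/
def RegularRankGeThree : Prop :=
  ∀ (K : Type) [Field K] [NumberField K] (n : ℕ) (hcpt : Literature.NumberTheory.Automorphic.isCompact_glFiniteIntegralLevel n K), 0 < n → 3 ≤ n → ∀ (ℓ : ℕ) [Fact ℓ.Prime] (ι : PadicAlgCl ℓ ≃+* ℂ) (ρ : Literature.NumberTheory.GaloisRepresentations.FramedGaloisRep K (PadicAlgCl ℓ) n), ρ.toGaloisRep.IsIrreducible → ((∀ᶠ v : IsDedekindDomain.HeightOneSpectrum (NumberField.RingOfIntegers K) in cofinite, ρ.IsUnramifiedAt v) ∧ ∀ (v : IsDedekindDomain.HeightOneSpectrum (NumberField.RingOfIntegers K)) (hv : ((ℓ : ℕ) : NumberField.RingOfIntegers K) ∈ v.asIdeal), (Literature.NumberTheory.PAdicHodge.fontainePstAdicCompletion v ℓ hv).IsDeRhamFramed (ρ.toLocal v)) → Summit.Langlands.Langlands.Theorems.WeightMultiplicitySplitMinusculeHodgeType.HodgeTateMultLE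 1 ρ → (∃ S : Set (IsDedekindDomain.HeightOneSpectrum (NumberField.RingOfIntegers K)), S.Finite ∧ ∀ r : NNReal, 0 < r → ∃ π : Literature.NumberTheory.Automorphic.CuspidalAutomorphicRepData n K hcpt, π.1.IsLAlgebraic ∧ ∀ v : IsDedekindDomain.HeightOneSpectrum (NumberField.RingOfIntegers K), v ∉ S → (∃ α : Multiset ℂ, π.1.HasSatakeParamAt v α ∧ ∀ 𝔓 ∈ v.primesAbove, ∀ σ : Field.absoluteGaloisGroup K, IsArithFrobAt (NumberField.RingOfIntegers K) σ 𝔓 → ∀ i : ℕ, Valued.v ((Literature.NumberTheory.GaloisRepresentations.FramedRep.charpoly ρ σ - Literature.NumberTheory.Automorphic.arithFrobPolyOfSatake ι v.residueCard 1 α).coeff i) < r)) → ∃ π : Literature.NumberTheory.Automorphic.CuspidalAutomorphicRepData n K hcpt, π.1.IsLAlgebraic ∧ ∀ᶠ v : IsDedekindDomain.HeightOneSpectrum (NumberField.RingOfIntegers K) in cofinite, SatakeFrobCompatibleAt ι π.1 ρ v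

/-- CG ⟹ its rank-≤-2 sub-box. -/
theorem regularRankLeTwo_of_regular (h : RegularClassicality) : RegularRankLeTwo :=
  fun K _ _ n hcpt hn _ ℓ _ ι ρ hirr hgeo hr hpro => h K n hcpt hn ℓ ι ρ hirr hgeo hr hpro

/-- CG ⟹ its rank-≥-3 sub-box. -/
theorem regularRankGeThree_of_regular (h : RegularClassicality) : RegularRankGeThree :=
  fun K _ _ n hcpt hn _ ℓ _ ι ρ hirr hgeo hr hpro => h K n hcpt hn ℓ ι ρ hirr hgeo hr hpro

/-- SEAM of CG's skeleton. -/
theorem regularClassicality_of_ranks (h2 : RegularRankLeTwo) (h3 : RegularRankGeThree) : RegularClassicality := by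
  intro K _ _ n hcpt hn ℓ _ ι ρ hirr hgeo hr hpro
  rcases Nat.lt_or_ge n 3 with hlt | hge
  · exact h2 K n hcpt hn (by omega) ℓ ι ρ hirr hgeo hr hpro
  · exact h3 K n hcpt hn hge ℓ ι ρ hirr hgeo hr hpro

/-- CG ⟺ (rank ≤ 2 sub-box) ∧ (rank ≥ 3 sub-box). -/
theorem regularClassicality_iff_ranks : RegularClassicality ↔ RegularRankLeTwo ∧ RegularRankGeThree :=
  ⟨fun h => ⟨regularRankLeTwo_of_regular h, regularRankGeThree_of_regular h⟩, fun h => regularClassicality_of_ranks h.1 h.2⟩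

/-- CD · rank ≤ 2 sub-box — a THEOREM: no degenerate type in rank ≤ 2. -/
def DegenerateRankLeTwo : Prop :=
  ∀ (K : Type) [Field K] [NumberField K] (n : ℕ) (hcpt : Literature.NumberTheory.Automorphic.isCompact_glFiniteIntegralLevel n K), 0 < n → n ≤ 2 → ∀ (ℓ : ℕ) [Fact ℓ.Prime] (ι : PadicAlgCl ℓ ≃+* ℂ) (ρ : Literature.NumberTheory.GaloisRepresentations.FramedGaloisRep K (PadicAlgCl ℓ) n), ρ.toGaloisRep.IsIrreducible → ((∀ᶠ v : IsDedekindDomain.HeightOneSpectrum (NumberField.RingOfIntegers K) in cofinite, ρ.IsUnramifiedAt v) ∧ ∀ (v : IsDedekindDomain.HeightOneSpectrum (NumberField.RingOfIntegers K)) (hv : ((ℓ : ℕ) : NumberField.RingOfIntegers K) ∈ v.asIdeal), (Literature.NumberTheory.PAdicHodge.fontainePstAdicCompletion v ℓ hv).IsDeRhamFramed (ρ.toLocal v)) → ¬ Summit.Langlands.Langlands.Theorems.WeightMultiplicitySplitMinusculeHodgeType.HodgeTateMultLE 2 ρ → (∃ S : Set (IsDedekindDomain.HeightOneSpectrum (NumberField.RingOfIntegers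 K)), S.Finite ∧ ∀ r : NNReal, 0 < r → ∃ π : Literature.NumberTheory.Automorphic.CuspidalAutomorphicRepData n K hcpt, π.1.IsLAlgebraic ∧ ∀ v : IsDedekindDomain.HeightOneSpectrum (NumberField.RingOfIntegers K), v ∉ S → (∃ α : Multiset ℂ, π.1.HasSatakeParamAt v α ∧ ∀ 𝔓 ∈ v.primesAbove, ∀ σ : Field.absoluteGaloisGroup K, IsArithFrobAt (NumberField.RingOfIntegers K) σ 𝔓 → ∀ i : ℕ, Valued.v ((Literature.NumberTheory.GaloisRepresentations.FramedRep.charpoly ρ σ - Literature.NumberTheory.Automorphic.arithFrobPolyOfSatake ι v.residueCard 1 α).coeff i) < r)) → ∃ π : Literature.NumberTheory.Automorphic.CuspidalAutomorphicRepData n K hcpt, π.1.IsLAlgebraic ∧ ∀ᶠ v : IsDedekindDomain.HeightOneSpectrum (NumberField.RingOfIntegers K) in cofinite, SatakeFrobCompatibleAt ι π.1 ρ v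

/-- CD · rank ≥ 3, Hodge–Tate ISOTYPIC sub-box (Artin type up to a labelled twist in rank ≥ 3: «pro-automorphic limits of Artin motives are
classical» — no Sen-theoretic engine, no Shimura realisation; registered core CMFern.ClassicalityOfArtinLimits 13888 for n ≥ 3) — stub
`stub_degenerateIsotypic` of CD's skeleton. -/
def DegenerateIsotypicRankGeThree : Prop :=
  ∀ (K : Type) [Field K] [NumberField K] (n : ℕ) (hcpt : Literature.NumberTheory.Automorphic.isCompact_glFiniteIntegralLevel n K), 0 < n → 3 ≤ n → ∀ (ℓ : ℕ) [Fact ℓ.Prime] (ι : PadicAlgCl ℓ ≃+* ℂ) (ρ : Literature.NumberTheory.GaloisRepresentations.FramedGaloisRep K (PadicAlgCl ℓ) n), ρ.toGaloisRep.IsIrreducible → ((∀ᶠ v : IsDedekindDomain.HeightOneSpectrum (NumberField.RingOfIntegers K) in cofinite, ρ.IsUnramifiedAt v) ∧ ∀ (v : IsDedekindDomain.HeightOneSpectrum (NumberField.RingOfIntegers K)) (hv : ((ℓ : ℕ) : NumberField.RingOfIntegers K) ∈ v.asIdeal), (Literature.NumberTheory.PAdicHodge.fontainePstAdicCompletion v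 ℓ hv).IsDeRhamFramed (ρ.toLocal v)) → ¬ Summit.Langlands.Langlands.Theorems.WeightMultiplicitySplitMinusculeHodgeType.HodgeTateMultLE 2 ρ → (∀ (v : IsDedekindDomain.HeightOneSpectrum (NumberField.RingOfIntegers K)) (hv : ((ℓ : ℕ) : NumberField.RingOfIntegers K) ∈ v.asIdeal) (τ : v.adicCompletion K →+* PadicAlgCl ℓ), Continuous τ → ∃ a : ℤ, ∀ w ∈ ρ.labelledHodgeTateWeightsAt v (Literature.NumberTheory.PAdicHodge.fontainePstAdicCompletion v ℓ hv).algebra (Literature.NumberTheory.PAdicHodge.fontainePstAdicCompletion v ℓ hv).𝔅 τ, w = a) → (∃ S : Set (IsDedekindDomain.HeightOneSpectrum (NumberField.RingOfIntegers K)), S.Finite ∧ ∀ r : NNReal, 0 < r → ∃ π : Literature.NumberTheory.Automorphic.CuspidalAutomorphicRepData n K hcpt, π.1.IsLAlgebraic ∧ ∀ v : IsDedekindDomain.HeightOneSpectrum (NumberField.RingOfIntegers K), v ∉ S → (∃ α : Multiset ℂ, π.1.HasSatakeParamAt v α ∧ ∀ 𝔓 ∈ v.primesAbove, ∀ σ :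 Field.absoluteGaloisGroup K, IsArithFrobAt (NumberField.RingOfIntegers K) σ 𝔓 → ∀ i : ℕ, Valued.v ((Literature.NumberTheory.GaloisRepresentations.FramedRep.charpoly ρ σ - Literature.NumberTheory.Automorphic.arithFrobPolyOfSatake ι v.residueCard 1 α).coeff i) < r)) → ∃ π : Literature.NumberTheory.Automorphic.CuspidalAutomorphicRepData n K hcpt, π.1.IsLAlgebraic ∧ ∀ᶠ v : IsDedekindDomain.HeightOneSpectrum (NumberField.RingOfIntegers K) in cofinite, SatakeFrobCompatibleAt ι π.1 ρ v

/-- CD · rank ≥ 3, NON-isotypic degenerate sub-box (a block of multiplicity ≥ 3 next to other weights) — stub `stub_degenerateMixed`. -/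
def DegenerateMixedRankGeThree : Prop :=
  ∀ (K : Type) [Field K] [NumberField K] (n : ℕ) (hcpt : Literature.NumberTheory.Automorphic.isCompact_glFiniteIntegralLevel n K), 0 < n → 3 ≤ n → ∀ (ℓ : ℕ) [Fact ℓ.Prime] (ι : PadicAlgCl ℓ ≃+* ℂ) (ρ : Literature.NumberTheory.GaloisRepresentations.FramedGaloisRep K (PadicAlgCl ℓ) n), ρ.toGaloisRep.IsIrreducible → ((∀ᶠ v : IsDedekindDomain.HeightOneSpectrum (NumberField.RingOfIntegers K) in cofinite, ρ.IsUnramifiedAt v) ∧ ∀ (v : IsDedekindDomain.HeightOneSpectrum (NumberField.RingOfIntegers K)) (hv : ((ℓ : ℕ) : NumberField.RingOfIntegers K) ∈ v.asIdeal), (Literature.NumberTheory.PAdicHodge.fontainePstAdicCompletion v ℓ hv).IsDeRhamFramed (ρ.toLocal v)) → ¬ Summit.Langlands.Langlands.Theorems.WeightMultiplicitySplitMinusculeHodgeType.HodgeTateMultLE 2 ρ → ¬ (∀ (v : IsDedekindDomain.HeightOneSpectrum (NumberField.RingOfIntegers K)) (hv : ((ℓ : ℕ) : NumberField.RingOfIntegers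 K) ∈ v.asIdeal) (τ : v.adicCompletion K →+* PadicAlgCl ℓ), Continuous τ → ∃ a : ℤ, ∀ w ∈ ρ.labelledHodgeTateWeightsAt v (Literature.NumberTheory.PAdicHodge.fontainePstAdicCompletion v ℓ hv).algebra (Literature.NumberTheory.PAdicHodge.fontainePstAdicCompletion v ℓ hv).𝔅 τ, w = a) → (∃ S : Set (IsDedekindDomain.HeightOneSpectrum (NumberField.RingOfIntegers K)), S.Finite ∧ ∀ r : NNReal, 0 < r → ∃ π : Literature.NumberTheory.Automorphic.CuspidalAutomorphicRepData n K hcpt, π.1.IsLAlgebraic ∧ ∀ v : IsDedekindDomain.HeightOneSpectrum (NumberField.RingOfIntegers K), v ∉ S → (∃ α : Multiset ℂ, π.1.HasSatakeParamAt v α ∧ ∀ 𝔓 ∈ v.primesAbove, ∀ σ : Field.absoluteGaloisGroup K, IsArithFrobAt (NumberField.RingOfIntegers K) σ 𝔓 → ∀ i : ℕ, Valued.v ((Literature.NumberTheory.GaloisRepresentations.FramedRep.charpoly ρ σ - Literature.NumberTheory.Automorphic.arithFrobPolyOfSatake ι v.residueCard 1 α).coeff i) < r)) → ∃ π : Literature.NumberTheory.Automorphic.CuspidalAutomorphicRepData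 n K hcpt, π.1.IsLAlgebraic ∧ ∀ᶠ v : IsDedekindDomain.HeightOneSpectrum (NumberField.RingOfIntegers K) in cofinite, SatakeFrobCompatibleAt ι π.1 ρ v

/-- CD · rank ≤ 2 is a THEOREM: the chamber is empty (tree `card = n`). -/
theorem degenerateRankLeTwo_holds : DegenerateRankLeTwo :=
  fun K _ _ n hcpt hn hle ℓ _ ι ρ hirr hgeo hd _ => (not_degenerate_of_rank_le_two hle hgeo hd).elim

/-- CD ⟹ its isotypic rank-≥-3 sub-box. -/
theorem degenerateIsotypic_of_degenerate (h : DegenerateClassicality) : DegenerateIsotypicRankGeThree :=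
  fun K _ _ n hcpt hn _ ℓ _ ι ρ hirr hgeo hd _ hpro => h K n hcpt hn ℓ ι ρ hirr hgeo hd hpro

/-- CD ⟹ its mixed rank-≥-3 sub-box. -/
theorem degenerateMixed_of_degenerate (h : DegenerateClassicality) : DegenerateMixedRankGeThree :=
  fun K _ _ n hcpt hn _ ℓ _ ι ρ hirr hgeo hd _ hpro => h K n hcpt hn ℓ ι ρ hirr hgeo hd hpro

/-- SEAM of CD's skeleton: rank ≤ 2 is the theorem above; at rank ≥ 3 excluded middle on the isotypic sub-dial. -/
theorem degenerateClassicality_of_ranks (hI : DegenerateIsotypicRankGeThree) (hM : DegenerateMixedRankGeThree) : DegenerateClassicality := by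
  intro K _ _ n hcpt hn ℓ _ ι ρ hirr hgeo hd hpro
  rcases Nat.lt_or_ge n 3 with hlt | hge
  · exact degenerateRankLeTwo_holds K n hcpt hn (by omega) ℓ ι ρ hirr hgeo hd hpro
  · by_cases hiso : IsHTIsotypic ρ
    · exact hI K n hcpt hn hge ℓ ι ρ hirr hgeo hd hiso hpro
    · exact hM K n hcpt hn hge ℓ ι ρ hirr hgeo hd hiso hpro

/-- CD ⟺ (isotypic rank ≥ 3) ∧ (mixed rank ≥ 3). -/
theorem degenerateClassicality_iff_ranks : DegenerateClassicality ↔ DegenerateIsotypicRankGeThree ∧ DegenerateMixedRankGeThree :=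
  ⟨fun h => ⟨degenerateIsotypic_of_degenerate h, degenerateMixed_of_degenerate h⟩, fun h => degenerateClassicality_of_ranks h.1 h.2⟩

/-- The node read through layer 2 (seven stubs + two theorems): `CLASS ⟺ CG₂ ∧ CG₃ ∧ CW₂ᵒᵈᵈ ∧ CW₂ⁿᵒⁿ⁻ᵒᵈᵈ ∧ CW₃ ∧ CD₃ᶦˢᵒ ∧ CD₃ᵐⁱˣ`. -/
theorem classicality_iff_layer2 : Summit.Langlands.Langlands.Theses.DepthPrimeSplit.Classicality ↔
    RegularRankLeTwo ∧ RegularRankGeThree ∧ WallRankTwoOdd ∧ WallRankTwoNonOdd ∧ WallRankGeThree ∧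
      DegenerateIsotypicRankGeThree ∧ DegenerateMixedRankGeThree := by
  rw [classicality_iff_cells, regularClassicality_iff_ranks, wallClassicality_iff_ranks, degenerateClassicality_iff_ranks]
  tauto

/-! ## 10. Guards -/

example (hL : _root_.Langlands) : RegularClassicality ∧ WallClassicality ∧ DegenerateClassicality ∧ ClassicalityFrame :=
  langlands_iff_pieces.1 hL

example : Assembly := fun hG hW hD hF => closes hG hW hD hF

end Summit.Langlands.Langlands.Theorems.DepthPrimeSplitClassicalityWeightLayers
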